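import Literature.NumberTheory.EllipticCurves.KubertTateFiveSelmerTameGaussian
import Literature.NumberTheory.NumberFields.UnitRankZeroPowerClassesSqrtNegTwo
import HarnessLib

/-!
# `Sel^φ(E_{m,n}/ℚ(√−2)) = 0` for the Kubert–Tate `5`-torsion family over `ℚ(√−2)` in the tame régime
# (the `φ`-side of the `5`-descent over the third quadratic field, class-wide, no named fact)

PROOF-ONLY file (theorems only, no definition, no named fact, no `sorry`), topic `NumberTheory/EllipticCurves`;
the `ℚ(√−2)` twin of the tree's `KubertTateFiveSelmerTameGaussian` (`ℚ(i)`) and `KubertTateFiveSelmerTameEisenstein`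
(`ℚ(ζ₃)`).  Base field: a number field `K` with `[K : ℚ] = 2` and `θ ∈ K`, `θ² = −2` (tree `SqrtNegTwo.FieldData θ`;
`𝓞 K = ℤ[√−2]` principal, no real place).  Mazur's étale-kernel descent over a number field
(`ConstantKernelIsogenySelmerTrivialNumberField.selmerGroup_eq_bot_of_classNumber_eq_one`, on the PROVED cyclic
Hilbert class field) kills the `φ`-Selmer group of Vélu's `5`-isogeny `φ : E_{m,n} → E_{m,n}/⟨(0,0)⟩`,
`E_{m,n} = [n-m, -mn, -mn², 0, 0]`, as soon as every finite place is étale or tame.  The tame condition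
`gcd(5, N𝔭 − 1) = 1` at a bad place `𝔭 ∣ ℓ` holds iff `ℓ ≢ 1 (mod 5)` and, when `ℓ ≡ 4 (mod 5)`, `N𝔭 = ℓ`, i.e. `ℓ`
SPLITS in `ℤ[√−2]` — certified here by an integer `x` with `ℓ ∥ x² + 2` (then `(θ − x)(θ + x) ∈ 𝔭` and
`N𝔭 ∣ N(θ ∓ x) = x² + 2`).

* §1 `residueCard_eq_or_eq_sq_sqrtNegTwo` (`N𝔭 ∈ {ℓ, ℓ²}`), **`residueCard_eq_of_dvd_sq_add_two`** (`ℓ ∥ x² + 2 ⟹ N𝔭 = ℓ`).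
* §2 `etale_or_tame_sqrtNegTwo` — every finite place of `K` is étale (`Δ ∉ 𝔭`) or tame (`5 ∉ 𝔭`, `gcd(5, N𝔭 − 1) = 1`)
  when `5 ∤ Δ(E_{m,n})` and every prime `ℓ ∣ Δ` has `ℓ ≢ 1 (mod 5)` and (`ℓ ≡ 4 (mod 5) ⇒ ∃ x, ℓ ∥ x² + 2`) — the
  `ℚ(√−2)` TAME RÉGIME.
* §3 **`selmerGroup_fiveIsogeny_eq_bot_sqrtNegTwo`** — `Sel^φ(E_{m,n}/K) = 0` in that régime; hence
  `E'_{m,n}(K) = φ(E_{m,n}(K))` (`exists_toGeomPoints_eq_sqrtNegTwo`) and `Ш(E_{m,n}/K)[φ] = 0`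
  (`ker_shaMap_fiveIsogeny_eq_bot_sqrtNegTwo`).

Why (stmt-BirchSwinnertonDyer-22356, «T = FiniteShaComponentTransfer»; BSD and T are NOT proved by this): with the
`μ₅`-side box over `K` this gives `rank E_{m,n}(K) + t₅ + 1 ≤ #{𝔭 ∣ mn}` and, since `Sel₅(E/K) = Sel₅(E/ℚ) ⊕ Sel₅(E^{(−8)}/ℚ)`
(`d_K = −8`), the door at `5` on the quadratic twists `E_{m,n}^{(−8)}` — curves WITHOUT rational `5`-torsion at which `5`
(INERT in `ℚ(√−2)`) is a NON-anomalous good ordinary prime, `a₅(E^{(−8)}) = −a₅(E) ≡ −1 (mod 5)`.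

## References

* [Mazur1977] B. Mazur, *Modular curves and the Eisenstein ideal*, Publ. Math. IHÉS 47 (1977), Ch. III §3 Thm. (3.1), Ch. I §1(g).
* [Fisher2001FiveSevenDescent] T. Fisher, *Some examples of 5 and 7 descent for elliptic curves over ℚ*, JEMS 3 (2001), §§1–2.
* [IrelandRosen1982] K. Ireland, M. Rosen, *A Classical Introduction to Modern Number Theory*, Ch. 13 §1 Prop. 13.1.3
  (splitting of `ℓ` in a quadratic field ⟺ `d` is a square mod `ℓ`).
* [SilvermanAEC2009] J. H. Silverman, *AEC*, 2nd ed., Thm. X.4.2.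
* [NeukirchANT1999] J. Neukirch, *Algebraic Number Theory* (1999), Ch. I §8 Prop. (8.2).
-/

noncomputable section

open scoped Classical
open Polynomial WeierstrassCurve NumberField IsDedekindDomain Field Ideal
open Literature.NumberTheory.EllipticCurves Literature.NumberTheory.GaloisRepresentations
  Literature.NumberTheory.NumberFields Literature.NumberTheory.QuadraticFields

namespace Literature.NumberTheory.EllipticCurves

namespace KubertTateVelu

/-! ## §1 Residue cardinalities of the finite places of `ℚ(√−2)` -/

section Places

variable {K : Type*} [Field K] [NumberField K] {θ : K}

/-- For any finite place `v ∋ ℓ` of the quadratic field `K`: `N v = ℓ` or `N v = ℓ²`. [cite: NeukirchANT1999, Ch. I §8 Prop. (8.2)] -/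
theorem residueCard_eq_or_eq_sq_sqrtNegTwo (hK : SqrtNegTwo.FieldData θ) (v : HeightOneSpectrum (𝓞 K)) {ℓ : ℕ}
    (hℓ : ℓ.Prime) (hℓv : (ℓ : 𝓞 K) ∈ v.asIdeal) : v.residueCard = ℓ ∨ v.residueCard = ℓ ^ 2 := by
  obtain ⟨h1, h2⟩ := one_le_inertiaDeg'_le_finrank v hℓ hℓv
  rw [hK.finrank_eq] at h2
  rw [residueCard_eq_pow_inertiaDeg' v hℓ hℓv]
  interval_cases (span {(ℓ : ℤ)}).inertiaDeg' v.asIdeal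
  · left; rw [pow_one]
  · right; rfl

/-- **Split primes of `ℤ[√−2]`**: if `ℓ ∥ x² + 2` for an integer `x` (`−2` a square mod `ℓ`, witnessed with `ℓ²∤`),
then every finite place `v ∋ ℓ` of `K = ℚ(√−2)` has `N v = ℓ`: `(θ − x)(θ + x) = −(x² + 2) ∈ v`, so `θ ∓ x ∈ v` and
`N v ∣ |N_{K/ℚ}(θ ∓ x)| = x² + 2`, which `ℓ²` does not divide. [cite: IrelandRosen1982, Ch. 13 §1 Prop. 13.1.3] -/
theorem residueCard_eq_of_dvd_sq_add_two (hK : SqrtNegTwo.FieldData θ) (v : HeightOneSpectrum (𝓞 K)) {ℓ : ℕ}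
    (hℓ : ℓ.Prime) (hℓv : (ℓ : 𝓞 K) ∈ v.asIdeal) {x : ℤ} (hx : (ℓ : ℤ) ∣ x ^ 2 + 2)
    (hx2 : ¬ (ℓ : ℤ) ^ 2 ∣ x ^ 2 + 2) : v.residueCard = ℓ := by
  haveI := v.isPrime
  -- `(θ - x)(θ + x) = -(x² + 2) ∈ v`, as elements `⟨-x, 1⟩ · ⟨x, 1⟩` of `ℤ[√−2]`
  obtain ⟨k, hk⟩ := hx
  have hprodZ : ((⟨-x, 1⟩ : ℤ√(-2)) * ⟨x, 1⟩) = ((-(x ^ 2 + 2) : ℤ) : ℤ√(-2)) := by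
    rw [Zsqrtd.intCast_val]
    ext
    · simp only [Zsqrtd.re_mul]; ring
    · simp only [Zsqrtd.im_mul]; ring
  have hprod : hK.ringEquiv ⟨-x, 1⟩ * hK.ringEquiv ⟨x, 1⟩ ∈ v.asIdeal := by
    rw [← map_mul, hprodZ, map_intCast, hk, show ((-(ℓ * k) : ℤ) : 𝓞 K) = (ℓ : 𝓞 K) * (-(k : 𝓞 K)) by push_cast; ring]
    exact v.asIdeal.mul_mem_right _ hℓv
  -- the norm of `θ ∓ x` is `x² + 2`
  have hnorm : ∀ a : ℤ, a ^ 2 = x ^ 2 → (Algebra.norm ℤ (hK.ringEquiv ⟨a, 1⟩)).natAbs = (x ^ 2 + 2).natAbs := by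
    intro a ha
    have hQ : ((Algebra.norm ℤ (hK.ringEquiv ⟨a, 1⟩) : ℤ) : ℚ) = ((x ^ 2 + 2 : ℤ) : ℚ) := by
      rw [Algebra.coe_norm_int]
      have e : ((hK.ringEquiv ⟨a, 1⟩ : 𝓞 K) : K) = ((a : ℚ) : K) + (((1 : ℤ) : ℚ) : K) * θ := by
        rw [hK.coe_ringEquiv]; push_cast; rfl
      rw [e, SqrtNegTwoIntegers.norm_ratCast_add_ratCast_mul hK.finrank_eq hK.sq_eq]
      have ha' : ((a : ℚ)) ^ 2 = (x : ℚ) ^ 2 := by exact_mod_cast ha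
      push_cast
      linear_combination ha'
    have hZ : Algebra.norm ℤ (hK.ringEquiv ⟨a, 1⟩) = x ^ 2 + 2 := by exact_mod_cast hQ
    rw [hZ]
  -- one of `θ ∓ x` lies in `v`; its norm is divisible by `N v`
  have hdvd : v.residueCard ∣ (x ^ 2 + 2).natAbs := by
    have key : ∀ a : ℤ, a ^ 2 = x ^ 2 → hK.ringEquiv ⟨a, 1⟩ ∈ v.asIdeal → v.residueCard ∣ (x ^ 2 + 2).natAbs := by
      intro a ha h
      have hle : span {hK.ringEquiv ⟨a, 1⟩} ≤ v.asIdeal := (span_singleton_le_iff_mem _).mpr h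
      have := Ideal.absNorm_dvd_absNorm_of_le hle
      rw [Ideal.absNorm_span_singleton, hnorm a ha] at this
      rw [HeightOneSpectrum.residueCard]; exact this
    rcases v.isPrime.mem_or_mem hprod with h | h
    · exact key (-x) (by ring) h
    · exact key x rfl h
  rcases residueCard_eq_or_eq_sq_sqrtNegTwo hK v hℓ hℓv with h | h
  · exact h
  · exfalso
    rw [h] at hdvd
    apply hx2
    have : ((ℓ ^ 2 : ℕ) : ℤ) ∣ x ^ 2 + 2 := Int.natCast_dvd.mpr hdvd
    exact_mod_cast this

end Places

/-! ## §2 The étale/tame hypothesis for `E_{m,n}` over `ℚ(√−2)` -/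

section SqrtNegTwo

variable {K : Type} [Field K] [NumberField K] {θ : K}
variable (m n : ℤ) [hE : (kubertTateFive (m : K) (n : K)).IsElliptic]

omit hE in
/-- **The étale/tame hypothesis over `ℚ(√−2)`, place by place (the `ℚ(√−2)` TAME RÉGIME).** If `5 ∤ Δ(E_{m,n})` and
every prime `ℓ ∣ Δ(E_{m,n})` satisfies `ℓ ≢ 1 (mod 5)` and (`ℓ ≡ 4 (mod 5) ⇒ ℓ ∥ x² + 2` for some integer `x`), then
every finite place `v` of `K` has `Δ(E_{m,n}) ∉ v`, or `5 ∉ v` and `gcd(5, N v − 1) = 1` (`N v = ℓ` at the split `ℓ`,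
`N v ∈ {ℓ, ℓ²}` always; `ℓ² ≡ 1 (mod 5)` iff `ℓ ≡ ±1`). [cite: Mazur1977, Ch. I §1(g)] [cite: IrelandRosen1982, Ch. 13 §1 Prop. 13.1.3] -/
theorem etale_or_tame_sqrtNegTwo (hK : SqrtNegTwo.FieldData θ) (h5 : ¬ (5 : ℤ) ∣ (kubertTateFive m n).Δ)
    (hbad : ∀ ℓ : ℕ, ℓ.Prime → (ℓ : ℤ) ∣ (kubertTateFive m n).Δ → ℓ % 5 ≠ 1 ∧
      (ℓ % 5 = 4 → ∃ x : ℤ, (ℓ : ℤ) ∣ x ^ 2 + 2 ∧ ¬ (ℓ : ℤ) ^ 2 ∣ x ^ 2 + 2))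
    (v : HeightOneSpectrum (𝓞 K)) :
    (((kubertTateFive m n).Δ : ℤ) : 𝓞 K) ∉ v.asIdeal ∨
      (((5 : ℕ) : 𝓞 K) ∉ v.asIdeal ∧ Nat.Coprime 5 (v.residueCard - 1)) := by
  obtain ⟨ℓ, hℓ, hℓv⟩ := exists_nat_prime_mem_asIdeal v
  haveI := liesOver_span_of_natCast_mem v hℓ hℓv
  by_cases hdvd : (ℓ : ℤ) ∣ (kubertTateFive m n).Δ
  · right
    obtain ⟨hℓ5, hℓsplit⟩ := hbad ℓ hℓ hdvd
    have hsplitN : ℓ % 5 = 4 → v.residueCard = ℓ := fun h4 ↦ by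
      obtain ⟨x, hx, hx2⟩ := hℓsplit h4
      exact residueCard_eq_of_dvd_sq_add_two hK v hℓ hℓv hx hx2
    clear hℓsplit
    have hℓne5 : ℓ ≠ 5 := by
      rintro rfl; exact h5 (by exact_mod_cast hdvd)
    constructor
    · -- `5 ∉ v`: otherwise `1 = aℓ + 5b ∈ v`
      intro h5v
      have hcop : Nat.Coprime ℓ 5 := (Nat.coprime_primes hℓ Nat.prime_five).mpr hℓne5
      obtain ⟨a, b, hab⟩ := Nat.isCoprime_iff_coprime.mpr hcop
      have hab' : a * (ℓ : ℤ) + b * 5 = 1 := by exact_mod_cast hab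
      apply v.isPrime.ne_top
      rw [Ideal.eq_top_iff_one]
      have h1 : ((a * ℓ + b * 5 : ℤ) : 𝓞 K) = 1 := by rw [hab']; norm_num
      rw [← h1]
      push_cast
      exact v.asIdeal.add_mem (v.asIdeal.mul_mem_left _ hℓv)
        (v.asIdeal.mul_mem_left _ (by exact_mod_cast h5v))
    · -- `gcd(5, N v - 1) = 1`
      rw [Nat.Prime.coprime_iff_not_dvd Nat.prime_five]
      have hℓmod : ℓ % 5 = 2 ∨ ℓ % 5 = 3 ∨ ℓ % 5 = 4 := by
        have h0 : ℓ % 5 ≠ 0 := fun h0 ↦ by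
          have : 5 ∣ ℓ := Nat.dvd_of_mod_eq_zero h0
          exact hℓne5 ((Nat.prime_dvd_prime_iff_eq Nat.prime_five hℓ).mp this).symm
        omega
      rcases hℓmod with h2 | h3 | h4
      · rcases residueCard_eq_or_eq_sq_sqrtNegTwo hK v hℓ hℓv with hN | hN <;> rw [hN]
        · omega
        · have : ℓ ^ 2 % 5 = 4 := by rw [Nat.pow_mod, h2]
          omega
      · rcases residueCard_eq_or_eq_sq_sqrtNegTwo hK v hℓ hℓv with hN | hN <;> rw [hN]
        · omega
        · have : ℓ ^ 2 % 5 = 4 := by rw [Nat.pow_mod, h3]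
          omega
      · rw [hsplitN h4]
        omega
  · left
    intro hΔ
    apply hdvd
    have h := (mem_of_liesOver v.asIdeal (span {(ℓ : ℤ)}) ((kubertTateFive m n).Δ)).mpr
      (by simpa using hΔ)
    exact mem_span_singleton.mp h

/-! ## §3 `Sel^φ(E_{m,n}/ℚ(√−2)) = 0` and its consequences -/

/-- **`Sel^φ(E_{m,n}/ℚ(√−2)) = 0` in the `ℚ(√−2)` tame régime** (`m, n ∈ ℤ`, `E_{m,n}` elliptic, `5 ∤ Δ(E_{m,n})`, every
prime `ℓ ∣ Δ` with `ℓ ≢ 1 (mod 5)` and `ℓ ≡ 4 (mod 5) ⇒ ℓ` split): the `ℤ/5`-side of the `5`-descent of `E_{m,n}` over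
`K = ℚ(√−2)` is empty — Mazur's étale-kernel descent over the number field `K`
(`ConstantKernelDescent.selmerGroup_eq_bot_of_classNumber_eq_one`: kernel constant, cyclic and integral, every
place étale or tame, `h(K) = 1`, no real place). [cite: Mazur1977, Ch. III §3 Thm. (3.1) with Ch. I §1(g)]
[cite: Fisher2001FiveSevenDescent, §§1–2] -/
theorem selmerGroup_fiveIsogeny_eq_bot_sqrtNegTwo (hK : SqrtNegTwo.FieldData θ) (h5 : ¬ (5 : ℤ) ∣ (kubertTateFive m n).Δ)
    (hbad : ∀ ℓ : ℕ, ℓ.Prime → (ℓ : ℤ) ∣ (kubertTateFive m n).Δ → ℓ % 5 ≠ 1 ∧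
      (ℓ % 5 = 4 → ∃ x : ℤ, (ℓ : ℤ) ∣ x ^ 2 + 2 ∧ ¬ (ℓ : ℤ) ^ 2 ∣ x ^ 2 + 2)) :
    (fiveIsogeny (m : K) (n : K)).selmerGroup = ⊥ := by
  haveI : Fact (Nat.Prime 5) := ⟨Nat.prime_five⟩
  haveI : IsAddCyclic (fiveIsogeny (m : K) (n : K)).toAddMonoidHom.ker :=
    isAddCyclic_of_prime_card (p := 5) (natCard_ker_fiveIsogeny (m : K) (n : K))
  exact ConstantKernelDescent.selmerGroup_eq_bot_of_classNumber_eq_one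
    (fiveIsogeny (m : K) (n : K)) (isEmpty_ringHom_real_sqrtNegTwo hK) (classNumber_eq_one_sqrtNegTwo hK)
    (kubertTateFive m n) (eq_map_int_of_field m n)
    (fun σ P hP ↦ smul_eq_of_mem_ker (m : K) (n : K) σ P hP) (exists_int_of_mem_ker_of_field m n)
    (n := 5) (by norm_num) (fun P hP ↦ five_nsmul_eq_zero_of_mem_ker (m : K) (n : K) hP)
    (etale_or_tame_sqrtNegTwo m n hK h5 hbad)

/-- **`E'_{m,n}(K) = φ(E_{m,n}(K))` in the `ℚ(√−2)` tame régime.** [cite: SilvermanAEC2009, Thm. X.4.2(a)] -/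
theorem exists_toGeomPoints_eq_sqrtNegTwo (hK : SqrtNegTwo.FieldData θ) (h5 : ¬ (5 : ℤ) ∣ (kubertTateFive m n).Δ)
    (hbad : ∀ ℓ : ℕ, ℓ.Prime → (ℓ : ℤ) ∣ (kubertTateFive m n).Δ → ℓ % 5 ≠ 1 ∧
      (ℓ % 5 = 4 → ∃ x : ℤ, (ℓ : ℤ) ∣ x ^ 2 + 2 ∧ ¬ (ℓ : ℤ) ^ 2 ∣ x ^ 2 + 2))
    (P' : (kubertTateFive' (m : K) (n : K)).toAffine.Point) :
    ∃ P : (kubertTateFive (m : K) (n : K)).toAffine.Point,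
      (kubertTateFive' (m : K) (n : K)).toGeomPoints P' =
        fiveIsogeny (m : K) (n : K) ((kubertTateFive (m : K) (n : K)).toGeomPoints P) :=
  ConstantKernelDescent.exists_toGeomPoints_eq_of_selmerGroup_eq_bot (fiveIsogeny (m : K) (n : K))
    (selmerGroup_fiveIsogeny_eq_bot_sqrtNegTwo m n hK h5 hbad) P'

/-- **`Ш(E_{m,n}/K)[φ] = 0` in the `ℚ(√−2)` tame régime.** [cite: SilvermanAEC2009, Thm. X.4.2(a)] -/
theorem ker_shaMap_fiveIsogeny_eq_bot_sqrtNegTwo (hK : SqrtNegTwo.FieldData θ) (h5 : ¬ (5 : ℤ) ∣ (kubertTateFive m n).Δ)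
    (hbad : ∀ ℓ : ℕ, ℓ.Prime → (ℓ : ℤ) ∣ (kubertTateFive m n).Δ → ℓ % 5 ≠ 1 ∧
      (ℓ % 5 = 4 → ∃ x : ℤ, (ℓ : ℤ) ∣ x ^ 2 + 2 ∧ ¬ (ℓ : ℤ) ^ 2 ∣ x ^ 2 + 2)) :
    (shaMap (fiveIsogeny (m : K) (n : K)).toAddMonoidHom (fiveIsogeny (m : K) (n : K)).equivariant
      (fiveIsogeny (m : K) (n : K)).hasLocalPointsMaps_toAddMonoidHom).ker = ⊥ :=
  ConstantKernelDescent.ker_shaMap_eq_bot_of_selmerGroup_eq_bot (fiveIsogeny (m : K) (n : K))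
    (selmerGroup_fiveIsogeny_eq_bot_sqrtNegTwo m n hK h5 hbad)

end SqrtNegTwo

end KubertTateVelu

end Literature.NumberTheory.EllipticCurves

end
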